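import Literature.AnabelianGeometry.SemiGraphs.HomOfEdgePacks
import HarnessLib

/-!
# The package of an OPEN edge: extending a morphism of semi-graphs of anabelioids along a MATCHED CUSP
# ([SemiAnbd] Cor. 3.11 proof pp. 46–47)

Mochizuki, *Semi-graphs of anabelioids*, Publ. RIMS **42** (2006), §3, Cor. 3.11, proof pp. 46–47: the
decomposition groups of the cusps correspond under `γ`, so "the natural, functorial isomorphism of graphs
of anabelioids `G[α]_Σ ⥲ G[β]_Σ` … extends … to … `G^c[α]_Σ ⥲ G^c[β]_Σ`"
[cite: MochizukiSemiAnbd2006, Cor 3.11 pp.46-47].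

CONSTRUCTION file (abc-iut cell, layer L3, sub-DAG SemiAnbd-Cor311, row «Cor311·C∃-LOCAL», seat
abc-iut-w4-d083), sequel of `HomOfEdgePacks.lean`.  For an open edge `e` of `𝒢` with its unique abutting
branch `b` at `v` and a MATCHING with a cusp of `ℋ` — a branch `b'` abutting to `V v`, the only abutting
branch of its edge, and a conjugator `g` with `hV_v(Π_b) = g · Π_{b'} · g⁻¹` (`CuspDatum`):

* `CuspDatum.eta` — the edge homomorphism `η := (b'_*)⁻¹ ∘ γ_{g⁻¹} ∘ hV_v ∘ b_* : Π_e → Π_{e(b')}`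
  (continuous: `b'_*` is a closed embedding of the compact `Π_{e(b')}`; `ℋ` of injective type), with
  `brHom_eta` and `eta_bijective` (onto by the matching, injective when `hV_v` is);
* `CuspDatum.βOpen` — the branch assignment (`b ↦ b'`, the other branch to the other branch);
* `CuspDatum.packOpen` — the resulting `EdgePack` at `e`.

Nothing here takes a side on [IUTchIII] Cor. 3.12.
-/

open CategoryTheory Topology

noncomputable section

namespace Literature.AnabelianGeometry.SemiGraphs

namespace ProfiniteSemiGraph

universe u

variable {𝒢 ℋ : ProfiniteSemiGraph.{u}}

namespace EdgePack

/-! ### The packages of the OPEN edges (cusps): extension along a matched cusp -/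

section Open

variable {V : 𝒢.graph.Vertex → ℋ.graph.Vertex} {hV : ∀ v, 𝒢.Gv v →ₜ* ℋ.Gv (V v)} {e : 𝒢.graph.Edge}

variable (V hV e) in
/-- A **matching of the cusp `e`** (an open edge with exactly one abutting branch `b` at `v`) with a cusp
of `ℋ` at `V v`: a branch `b'` of `ℋ` abutting to `V v`, the only abutting branch of its edge, and a
conjugator `g` with `hV_v(Π_b) = g · Π_{b'} · g⁻¹` (the shape of the cusp correspondence in the proof of
Cor. 3.11, pp. 46–47). [cite: MochizukiSemiAnbd2006, Cor 3.11 pp.46-47] -/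
structure CuspDatum : Type u where
  /-- the abutting branch of the cusp `e` -/
  b : 𝒢.graph.Branch
  /-- the vertex it abuts to -/
  v : 𝒢.graph.Vertex
  hbe : 𝒢.graph.edgeOf b = e
  hb : 𝒢.graph.abuts b = some v
  /-- `b` is the only abutting branch of `e` -/
  huniq : ∀ b₁ : 𝒢.graph.Branch, 𝒢.graph.edgeOf b₁ = e → (𝒢.graph.abuts b₁).isSome = true → b₁ = b
  /-- the matched branch of `ℋ` -/
  b' : ℋ.graph.Branch
  hb' : ℋ.graph.abuts b' = some (V v)
  /-- `b'` is the only abutting branch of its edge -/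
  huniq' : ∀ b₁ : ℋ.graph.Branch, ℋ.graph.edgeOf b₁ = ℋ.graph.edgeOf b' →
    (ℋ.graph.abuts b₁).isSome = true → b₁ = b'
  /-- the conjugator -/
  g : ℋ.Gv (V v)
  /-- `hV_v(Π_b) = g · Π_{b'} · g⁻¹` -/
  hmatch : (𝒢.branchSubgroup b v hb).map (hV v).toMonoidHom =
    (ℋ.branchSubgroup b' (V v) hb').map (MulAut.conj g).toMonoidHom

namespace CuspDatum

variable (D : CuspDatum V hV e)

/-- `g⁻¹ · hV_v(b_*(-)) · g : Π_e → Π_{V v}`. [cite: MochizukiSemiAnbd2006, Cor 3.11 p.47] -/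
def aux : 𝒢.Ge e →ₜ* ℋ.Gv (V D.v) where
  toMonoidHom := (MulAut.conj D.g⁻¹).toMonoidHom.comp
    ((hV D.v).toMonoidHom.comp (𝒢.brHomAt D.b D.v D.hb e D.hbe).toMonoidHom)
  continuous_toFun := by
    change Continuous fun y => D.g⁻¹ * hV D.v (𝒢.brHomAt D.b D.v D.hb e D.hbe y) * (D.g⁻¹)⁻¹
    exact (continuous_const.mul ((hV D.v).continuous.comp (𝒢.brHomAt D.b D.v D.hb e D.hbe).continuous)).mul
      continuous_const

/-- `aux` evaluated. [cite: MochizukiSemiAnbd2006, Cor 3.11 p.47] -/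
theorem aux_apply (y : 𝒢.Ge e) :
    D.aux y = D.g⁻¹ * hV D.v (𝒢.brHomAt D.b D.v D.hb e D.hbe y) * D.g := by
  change D.g⁻¹ * hV D.v (𝒢.brHomAt D.b D.v D.hb e D.hbe y) * (D.g⁻¹)⁻¹ = _
  rw [inv_inv]

/-- `aux` lands in `Π_{b'} = b'_*(Π_{e'})` (the matching). [cite: MochizukiSemiAnbd2006, Cor 3.11 p.47] -/
theorem aux_mem (y : 𝒢.Ge e) : D.aux y ∈ (ℋ.brHom D.b' (V D.v) D.hb').toMonoidHom.range := by
  have h1 : hV D.v (𝒢.brHomAt D.b D.v D.hb e D.hbe y) ∈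
      (𝒢.branchSubgroup D.b D.v D.hb).map (hV D.v).toMonoidHom := by
    refine ⟨𝒢.brHomAt D.b D.v D.hb e D.hbe y, ?_, rfl⟩
    rw [brHomAt_apply]
    exact ⟨_, rfl⟩
  rw [D.hmatch] at h1
  obtain ⟨z, hz, hzy⟩ := h1
  rw [aux_apply, ← hzy]
  change D.g⁻¹ * (D.g * z * D.g⁻¹) * D.g ∈ _
  have : D.g⁻¹ * (D.g * z * D.g⁻¹) * D.g = z := by group
  rw [this]
  exact hz

variable (hinj : ℋ.IsOfInjectiveType)

/-- `b'_* : Π_{e'} ⥲ Π_{b'}` as a homeomorphic group isomorphism onto its range (injective type; compact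
source, Hausdorff target). [cite: MochizukiSemiAnbd2006, Def 2.1 p.22] -/
def rangeHomeo : ℋ.Ge (ℋ.graph.edgeOf D.b') ≃ₜ (ℋ.brHom D.b' (V D.v) D.hb').toMonoidHom.range :=
  Continuous.homeoOfEquivCompactToT2
    (f := (MonoidHom.ofInjective (hinj D.b' (V D.v) D.hb')).toEquiv)
    ((ℋ.brHom D.b' (V D.v) D.hb').continuous.subtype_mk _)

/-- **The edge homomorphism along the matched cusp**: `η := (b'_*)⁻¹ ∘ γ_{g⁻¹} ∘ hV_v ∘ b_*`.
[cite: MochizukiSemiAnbd2006, Cor 3.11 p.47] -/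
def eta : 𝒢.Ge e →ₜ* ℋ.Ge (ℋ.graph.edgeOf D.b') where
  toMonoidHom := (MonoidHom.ofInjective (hinj D.b' (V D.v) D.hb')).symm.toMonoidHom.comp
    (D.aux.toMonoidHom.codRestrict _ D.aux_mem)
  continuous_toFun := by
    change Continuous fun y => (D.rangeHomeo hinj).symm (⟨D.aux y, D.aux_mem y⟩)
    exact (D.rangeHomeo hinj).symm.continuous.comp (D.aux.continuous.subtype_mk _)

/-- The defining property of `η`: `b'_*(η y) = g⁻¹ · hV_v(b_* y) · g`.
[cite: MochizukiSemiAnbd2006, Cor 3.11 p.47] -/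
theorem brHom_eta (y : 𝒢.Ge e) :
    ℋ.brHom D.b' (V D.v) D.hb' (D.eta hinj y) =
      D.g⁻¹ * hV D.v (𝒢.brHomAt D.b D.v D.hb e D.hbe y) * D.g := by
  rw [← aux_apply]
  exact MonoidHom.apply_ofInjective_symm (hinj D.b' (V D.v) D.hb') ⟨D.aux y, D.aux_mem y⟩

/-- `η` is bijective (when `hV_v` and `b_*` are injective; onto by the matching).
[cite: MochizukiSemiAnbd2006, Cor 3.11 p.47] -/
theorem eta_bijective (hinj𝒢 : 𝒢.IsOfInjectiveType) (hVinj : Function.Injective (hV D.v)) :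
    Function.Bijective (D.eta hinj) := by
  refine ⟨fun y₁ y₂ h => ?_, fun z => ?_⟩
  · have h1 := congrArg (ℋ.brHom D.b' (V D.v) D.hb') h
    rw [brHom_eta, brHom_eta] at h1
    have h2 := hVinj (mul_left_cancel (mul_right_cancel h1))
    rw [brHomAt_apply, brHomAt_apply] at h2
    have h3 := hinj𝒢 D.b D.v D.hb h2
    have : ∀ (e₁ : 𝒢.graph.Edge) (q : 𝒢.graph.edgeOf D.b = e₁) (a₁ a₂ : 𝒢.Ge e₁), q ▸ a₁ = q ▸ a₂ → a₁ = a₂ := by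
      intro e₁ q a₁ a₂ hq; subst q; exact hq
    exact this e D.hbe y₁ y₂ h3
  · have hz : D.g * ℋ.brHom D.b' (V D.v) D.hb' z * D.g⁻¹ ∈
        (ℋ.branchSubgroup D.b' (V D.v) D.hb').map (MulAut.conj D.g).toMonoidHom :=
      ⟨_, ⟨z, rfl⟩, rfl⟩
    rw [← D.hmatch] at hz
    obtain ⟨_, ⟨y₀, rfl⟩, hy⟩ := hz
    have hlift : ∀ (e₁ : 𝒢.graph.Edge) (q : 𝒢.graph.edgeOf D.b = e₁) (a : 𝒢.Ge (𝒢.graph.edgeOf D.b)),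
        ∃ y : 𝒢.Ge e₁, 𝒢.brHomAt D.b D.v D.hb e₁ q y = 𝒢.brHom D.b D.v D.hb a := by
      intro e₁ q a; subst q; exact ⟨a, rfl⟩
    obtain ⟨y, hyq⟩ := hlift e D.hbe y₀
    refine ⟨y, hinj D.b' (V D.v) D.hb' ?_⟩
    rw [brHom_eta, hyq]
    have h1 : (hV D.v) (𝒢.brHom D.b D.v D.hb y₀) = D.g * ℋ.brHom D.b' (V D.v) D.hb' z * D.g⁻¹ := hy
    rw [h1]
    group

end CuspDatum


/-- Re-indexed branch homomorphisms at equal branches agree. [cite: MochizukiSemiAnbd2006, Def 2.1 p.22] -/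
theorem brHomAt_congr {b₁ b₂ : ℋ.graph.Branch} (hb : b₁ = b₂) {w : ℋ.graph.Vertex}
    (h₁ : ℋ.graph.abuts b₁ = some w) (h₂ : ℋ.graph.abuts b₂ = some w) {f : ℋ.graph.Edge}
    (q₁ : ℋ.graph.edgeOf b₁ = f) (q₂ : ℋ.graph.edgeOf b₂ = f) (y : ℋ.Ge f) :
    ℋ.brHomAt b₁ w h₁ f q₁ y = ℋ.brHomAt b₂ w h₂ f q₂ y := by
  subst hb; rfl

/-- The other branch of the edge of a branch. [cite: MochizukiSemiAnbd2006, §1 p.11] -/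
theorem exists_otherBranch (b' : ℋ.graph.Branch) : ∃ c : ℋ.graph.Branch,
    ℋ.graph.edgeOf c = ℋ.graph.edgeOf b' ∧ c ≠ b' ∧
      ∀ d, ℋ.graph.edgeOf d = ℋ.graph.edgeOf b' → d = b' ∨ d = c := by
  obtain ⟨b₁, b₂, hne, h₁, h₂, hall⟩ := ℋ.graph.two_branches (ℋ.graph.edgeOf b')
  by_cases hb : b' = b₁
  · subst hb
    exact ⟨b₂, h₂, hne.symm, fun d hd => hall d hd⟩
  · have hb2 : b' = b₂ := (hall b' rfl).resolve_left hb
    subst hb2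
    exact ⟨b₁, h₁, hne, fun d hd => (hall d hd).symm⟩

/-- A chosen other branch. [cite: MochizukiSemiAnbd2006, §1 p.11] -/
def otherBranch (b' : ℋ.graph.Branch) : ℋ.graph.Branch := Classical.choose (exists_otherBranch b')

/-- Its specification. [cite: MochizukiSemiAnbd2006, §1 p.11] -/
theorem otherBranch_spec (b' : ℋ.graph.Branch) :
    ℋ.graph.edgeOf (otherBranch b') = ℋ.graph.edgeOf b' ∧ otherBranch b' ≠ b' ∧
      ∀ d, ℋ.graph.edgeOf d = ℋ.graph.edgeOf b' → d = b' ∨ d = otherBranch b' :=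
  Classical.choose_spec (exists_otherBranch b')

namespace CuspDatum

variable (D : CuspDatum V hV e) (hinj : ℋ.IsOfInjectiveType)

open Classical in
/-- The branch assignment along the matched cusp: the abutting branch to `b'`, the other branch to the
other branch of `e(b')`. [cite: MochizukiSemiAnbd2006, Cor 3.11 p.47] -/
def βOpen (bb : {b₁ : 𝒢.graph.Branch // 𝒢.graph.edgeOf b₁ = e}) :
    {c : ℋ.graph.Branch // ℋ.graph.edgeOf c = ℋ.graph.edgeOf D.b'} :=
  if bb.1 = D.b then ⟨D.b', rfl⟩ else ⟨otherBranch D.b', (otherBranch_spec D.b').1⟩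

/-- On the abutting branch. [cite: MochizukiSemiAnbd2006, Cor 3.11 p.47] -/
theorem βOpen_val_of_eq {bb : {b₁ : 𝒢.graph.Branch // 𝒢.graph.edgeOf b₁ = e}} (h : bb.1 = D.b) :
    (D.βOpen bb).1 = D.b' := by
  simp [βOpen, h]

/-- On the other branch. [cite: MochizukiSemiAnbd2006, Cor 3.11 p.47] -/
theorem βOpen_val_of_ne {bb : {b₁ : 𝒢.graph.Branch // 𝒢.graph.edgeOf b₁ = e}} (h : bb.1 ≠ D.b) :
    (D.βOpen bb).1 = otherBranch D.b' := by
  simp [βOpen, h]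

/-- A branch of `e` other than `b` does not abut. [cite: MochizukiSemiAnbd2006, §1 p.13] -/
theorem abuts_eq_none_of_ne {bb : {b₁ : 𝒢.graph.Branch // 𝒢.graph.edgeOf b₁ = e}} (h : bb.1 ≠ D.b) :
    𝒢.graph.abuts bb.1 = none := by
  by_contra hne
  exact h (D.huniq bb.1 bb.2 (Option.ne_none_iff_isSome.mp hne))

/-- The other branch of `e(b')` does not abut. [cite: MochizukiSemiAnbd2006, §1 p.13] -/
theorem abuts_otherBranch : ℋ.graph.abuts (otherBranch D.b') = none := by
  by_contra hne
  exact (otherBranch_spec D.b').2.1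
    (D.huniq' _ (otherBranch_spec D.b').1 (Option.ne_none_iff_isSome.mp hne))

/-- **The package of an OPEN edge** (a matched cusp). [cite: MochizukiSemiAnbd2006, Cor 3.11 p.47] -/
def packOpen : EdgePack V hV e where
  f := ℋ.graph.edgeOf D.b'
  η := D.eta hinj
  β := D.βOpen
  β_injective := by
    intro b₁ b₂ h
    by_cases h₁ : b₁.1 = D.b <;> by_cases h₂ : b₂.1 = D.b
    · exact Subtype.ext (h₁.trans h₂.symm)
    · exfalso
      have := congrArg Subtype.val h
      rw [D.βOpen_val_of_eq h₁, D.βOpen_val_of_ne h₂] at this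
      exact (otherBranch_spec D.b').2.1 this.symm
    · exfalso
      have := congrArg Subtype.val h
      rw [D.βOpen_val_of_ne h₁, D.βOpen_val_of_eq h₂] at this
      exact (otherBranch_spec D.b').2.1 this
    · -- both are the non-abutting branch of `e`
      obtain ⟨c₁, c₂, hne, hc₁, hc₂, hall⟩ := 𝒢.graph.two_branches e
      have hb : D.b = c₁ ∨ D.b = c₂ := hall D.b D.hbe
      rcases hall b₁.1 b₁.2 with e₁ | e₁ <;> rcases hall b₂.1 b₂.2 with e₂ | e₂
      · exact Subtype.ext (e₁.trans e₂.symm)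
      · rcases hb with hb | hb
        · exact absurd (e₁.trans hb.symm) h₁
        · exact absurd (e₂.trans hb.symm) h₂
      · rcases hb with hb | hb
        · exact absurd (e₂.trans hb.symm) h₂
        · exact absurd (e₁.trans hb.symm) h₁
      · exact Subtype.ext (e₁.trans e₂.symm)
  β_abuts bb v₁ h₁ := by
    have hbb : bb.1 = D.b := D.huniq bb.1 bb.2 (by rw [h₁]; rfl)
    have hv : v₁ = D.v := by
      have := D.hb; rw [← hbb, h₁] at this; exact Option.some.inj this
    subst hv
    show ℋ.graph.abuts (D.βOpen bb).1 = some (V D.v)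
    rw [D.βOpen_val_of_eq hbb]
    exact D.hb'
  β_none bb h0 := by
    have hbb : bb.1 ≠ D.b := by
      intro h; have := D.hb; rw [← h, h0] at this; exact absurd this (by simp)
    show ℋ.graph.abuts (D.βOpen bb).1 = none
    rw [D.βOpen_val_of_ne hbb]
    exact D.abuts_otherBranch
  comm bb v₁ h₁ := by
    have hbb : bb.1 = D.b := D.huniq bb.1 bb.2 (by rw [h₁]; rfl)
    have hv : v₁ = D.v := by
      have := D.hb; rw [← hbb, h₁] at this; exact Option.some.inj this
    subst hv
    refine ⟨D.g, fun y => ?_⟩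
    have hβ : (D.βOpen bb).1 = D.b' := D.βOpen_val_of_eq hbb
    rw [brHomAt_congr hβ _ D.hb' (D.βOpen bb).2 rfl, brHomAt_rfl, D.brHom_eta hinj]
    obtain ⟨b₁, hb₁e⟩ := bb
    change b₁ = D.b at hbb
    subst hbb
    group

/-- The target edge of the open package (definitional). [cite: MochizukiSemiAnbd2006, Cor 3.11 p.47] -/
@[simp] theorem packOpen_f : (D.packOpen hinj).f = ℋ.graph.edgeOf D.b' := rfl

/-- The edge homomorphism of the open package (definitional). [cite: MochizukiSemiAnbd2006, Cor 3.11 p.47] -/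
@[simp] theorem packOpen_η : (D.packOpen hinj).η = D.eta hinj := rfl

end CuspDatum

end Open

end EdgePack

end ProfiniteSemiGraph

end Literature.AnabelianGeometry.SemiGraphs

end
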